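import Literature.MathematicalPhysics.KineticTheory.CollisionWindowCompensator
import Literature.MathematicalPhysics.KineticTheory.HardSphereDisplacementPathLength
import Literature.MathematicalPhysics.KineticTheory.CollisionTubeWeightOscillation
import HarnessLib

/-!
# Bookkeeping of a collision sum against the time windows of the window compensator

Topic `Literature/MathematicalPhysics/KineticTheory` — companion of `CollisionWindowCompensator.lean` (windows
`window N τ a k = [kw, (k+1)w)`, `Kw · w = τ`, windowed collision counts `windowCollisions`, window sums
`windowSum`, the hazard weight `hazardWeight`).  Theorems only (no definitions): the elementary, dynamics-free or
pathwise facts used to compare a per-collision sum `Σ_i Σ_{s ∈ CT_i ∩ [0,τ]} F_i(s)` along a good hard-sphere orbit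
with the window sum `Σ_i Σ_{k<Kw} h_{i,k} D_{i,k}` of weights frozen at the window starts (Cercignani–Illner–Pulvirenti
1994, App. 4.A: collisions in short time windows; Gallagher–Saint-Raymond–Texier 2013, §4.1: good orbits are piecewise
free flight with locally finitely many, binary collisions).

* §1 Window arithmetic: a time `s ∈ [0, τ)` lies in the window `⌊s/w⌋ < Kw`; membership in window `k` read off the
  floor; windows `k < Kw` lie in `[0, τ)`.
* §2 **The abstract window bookkeeping inequality** (`abs_sum_sub_sum_mul_le`): for a finite set of times
  `T ⊆ [0, τ]`, values `F`, frozen weights `h_k`, window "path lengths" `P_k ≥ 0` and the window counts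
  `D_k = #(T ∩ window k)`, if `|F|, |h| ≤ C` and every time in a window with `P_k ≤ λ` is GOOD (`|F(s) − h_k| ≤ η`), then
  `|Σ_{s∈T} F(s) − Σ_{k<Kw} h_k D_k| ≤ C·1{τ ∈ T} + Σ_{k<Kw} ((η + Cθ) D_k² + (C/(θλ)) P_k)` for every `θ > 0`
  (good windows cost `η D ≤ η D²`; a bad window costs `2C D ≤ CθD² + C/θ ≤ CθD² + (C/(θλ)) P_k` by AM–GM and `P_k > λ`;
  the time `τ` itself is in no window).
* §3 Cell geometry: a point of `𝕋³` is within `r'` of the centre of its `r'`-cell; the coarse mollified density is a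
  mollified density of the cell centres (hence `≤ 3/(πr³)`); the hazard weight at a window start, unfolded.
* §4 Binary collisions: at any time at most two spheres participate (`Σ_i 1{i participates} ≤ 2`).
* §5 Path lengths and energy along a good orbit: the window path lengths of one sphere add up to `∫₀^τ ‖v_i‖`, and
  `Σ_i ∫_{t₁}^{t₂} ‖v_i‖ ≤ (t₂ − t₁)(N/2 + E)` (`‖v‖ ≤ ½ + ½‖v‖²`, `Σ_i ‖v_i‖² = 2E` conserved).
* §6 `(N+1)^{-1/3} → 0` in the `∃ N₀ ∀ N ≥ N₀` form.

## References

* C. Cercignani, R. Illner, M. Pulvirenti, *The Mathematical Theory of Dilute Gases* (1994), App. 4.A.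
  [CIPDiluteGases1994]
* I. Gallagher, L. Saint-Raymond, B. Texier, *From Newton to Boltzmann* (2013), §4.1.  [GST2013]

## Not here

The frozen-weight (modulus of continuity) estimate and the window reduction of the crux line `Sketch` of
`InformationPercolationEngine.CollisionRate` are problem-side (`Summits/…/Theorems/…WindowReductionCollision.lean`).
-/

noncomputable section

open scoped BigOperators Classical ENNReal
open Set MeasureTheory Filter
open Literature.Analysis.FluidPDE

namespace Literature.MathematicalPhysics.KineticTheory

/-! ## §1 Window arithmetic -/

/-- A time `s < τ` lies in one of the first `Kw` windows: `⌊s / w⌋ < Kw` (`Kw · w = τ`; for `s < 0` the natural floor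
is `0 < Kw`). [folklore] -/
theorem floor_div_windowLen_lt (N : ℕ) {τ a : ℝ} (hτ : 0 < τ) (ha : 0 < a) {s : ℝ} (hs : s < τ) :
    ⌊s / windowLen N τ a⌋₊ < windowNum N τ a := by
  have hw := windowLen_pos N hτ ha
  rcases lt_or_ge s 0 with hs0 | hs0
  · rw [Nat.floor_of_nonpos (div_nonpos_of_nonpos_of_nonneg hs0.le hw.le)]
    exact windowNum_pos N hτ ha
  · rw [Nat.floor_lt (div_nonneg hs0 hw.le), div_lt_iff₀ hw, windowNum_mul_windowLen N hτ ha]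
    exact hs

/-- Membership in window `k` read off the floor: `s ∈ [kw, (k+1)w)` iff `0 ≤ s` and `⌊s / w⌋ = k`. [folklore] -/
theorem mem_window_iff (N : ℕ) {τ a : ℝ} (hτ : 0 < τ) (ha : 0 < a) (k : ℕ) (s : ℝ) :
    s ∈ window N τ a k ↔ 0 ≤ s ∧ ⌊s / windowLen N τ a⌋₊ = k := by
  have hw := windowLen_pos N hτ ha
  unfold window
  constructor
  · rintro ⟨h1, h2⟩
    have hs0 : 0 ≤ s := le_trans (by positivity) h1
    refine ⟨hs0, (Nat.floor_eq_iff (div_nonneg hs0 hw.le)).2 ⟨?_, ?_⟩⟩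
    · rwa [le_div_iff₀ hw]
    · rwa [div_lt_iff₀ hw]
  · rintro ⟨hs0, hk⟩
    obtain ⟨h1, h2⟩ := (Nat.floor_eq_iff (div_nonneg hs0 hw.le)).1 hk
    exact ⟨(le_div_iff₀ hw).1 h1, (div_lt_iff₀ hw).1 h2⟩

/-- The first `Kw` windows lie in `[0, τ)`. [folklore] -/
theorem window_subset_Ico (N : ℕ) {τ a : ℝ} (hτ : 0 < τ) (ha : 0 < a) {k : ℕ} (hk : k < windowNum N τ a) :
    window N τ a k ⊆ Ico 0 τ := by
  have hw := windowLen_pos N hτ ha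
  rintro s ⟨h1, h2⟩
  refine ⟨le_trans (by positivity) h1, lt_of_lt_of_le h2 ?_⟩
  have : (k : ℝ) + 1 ≤ windowNum N τ a := by exact_mod_cast hk
  calc ((k : ℝ) + 1) * windowLen N τ a ≤ (windowNum N τ a : ℝ) * windowLen N τ a :=
        mul_le_mul_of_nonneg_right this hw.le
    _ = τ := windowNum_mul_windowLen N hτ ha

/-! ## §2 The abstract window bookkeeping inequality -/

/-- AM–GM in the form used for a bad window: `D ≤ (θ/2) D² + 1/(2θ)` for `θ > 0`. [folklore] -/
theorem le_half_mul_sq_add {θ : ℝ} (hθ : 0 < θ) (D : ℝ) : D ≤ θ / 2 * D ^ 2 + 1 / (2 * θ) := by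
  rw [← sub_nonneg]
  have : θ / 2 * D ^ 2 + 1 / (2 * θ) - D = (θ * D - 1) ^ 2 / (2 * θ) := by
    field_simp
    ring
  rw [this]
  positivity

/-- **The abstract window bookkeeping inequality.**  Let `T ⊆ [0, τ]` be a finite set of times, `F` real values on
it, `h_k` frozen window weights, `P_k ≥ 0` window path lengths and `D_k = #(T ∩ [kw, (k+1)w))` the window counts
(`k < Kw`, `Kw · w = τ`).  If `|F| ≤ C` on `T`, `|h_k| ≤ C`, and `|F(s) − h_k| ≤ η` for every `s ∈ T` in a window `k`
with `P_k ≤ λ`, then for every `θ > 0`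
`|Σ_{s ∈ T} F(s) − Σ_{k<Kw} h_k D_k| ≤ C · 1{τ ∈ T} + Σ_{k<Kw} ((η + Cθ) D_k² + (C/(θλ)) P_k)`:
the times `< τ` are distributed into the windows by `⌊s/w⌋`; a good window costs `η D_k ≤ η D_k²`, a bad one
`2C D_k ≤ Cθ D_k² + C/θ < Cθ D_k² + (C/(θλ)) P_k`; the time `τ` lies in no window.
[cite: CIPDiluteGases1994, App. 4.A] -/
theorem abs_sum_sub_sum_mul_le (N : ℕ) {τ a : ℝ} (hτ : 0 < τ) (ha : 0 < a) {T : Finset ℝ}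
    (hT : ∀ s ∈ T, s ∈ Icc 0 τ) (F : ℝ → ℝ) (h P D : ℕ → ℝ) {C η θ lam : ℝ} (hC : 0 ≤ C)
    (hη : 0 ≤ η) (hθ : 0 < θ) (hlam : 0 < lam) (hP : ∀ k, 0 ≤ P k)
    (hD : ∀ k < windowNum N τ a, D k = ((T.filter fun s => s ∈ window N τ a k).card : ℝ))
    (hF : ∀ s ∈ T, |F s| ≤ C) (hh : ∀ k < windowNum N τ a, |h k| ≤ C)
    (hgood : ∀ k < windowNum N τ a, ∀ s ∈ T, s ∈ window N τ a k → P k ≤ lam → |F s - h k| ≤ η) :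
    |∑ s ∈ T, F s - ∑ k ∈ Finset.range (windowNum N τ a), h k * D k| ≤
      C * (if τ ∈ T then 1 else 0) +
        ∑ k ∈ Finset.range (windowNum N τ a), ((η + C * θ) * D k ^ 2 + C / (θ * lam) * P k) := by
  classical
  set Kw := windowNum N τ a with hKw
  set w := windowLen N τ a with hw_def
  have hw := windowLen_pos N hτ ha
  -- split `T` into the times `< τ` and the time `τ`
  set T' := T.filter (fun s => s < τ) with hT'
  set T'' := T.filter (fun s => ¬ s < τ) with hT''
  have hsplit : ∑ s ∈ T, F s = ∑ s ∈ T', F s + ∑ s ∈ T'', F s :=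
    (Finset.sum_filter_add_sum_filter_not T (fun s => s < τ) F).symm
  have hT''sub : T'' ⊆ {τ} := by
    intro s hs
    rw [Finset.mem_filter] at hs
    rw [Finset.mem_singleton]
    exact le_antisymm (hT s hs.1).2 (not_lt.1 hs.2)
  have hτpart : |∑ s ∈ T'', F s| ≤ C * (if τ ∈ T then 1 else 0) := by
    by_cases hτT : τ ∈ T
    · have hTeq : T'' = {τ} := by
        refine Finset.Subset.antisymm hT''sub fun s hs => ?_
        rw [Finset.mem_singleton] at hs
        subst hs
        exact Finset.mem_filter.2 ⟨hτT, lt_irrefl _⟩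
      rw [hTeq, Finset.sum_singleton, if_pos hτT, mul_one]
      exact hF τ hτT
    · have hTeq : T'' = ∅ := by
        refine Finset.eq_empty_of_forall_notMem fun s hs => hτT ?_
        have hs' := hT''sub hs
        rw [Finset.mem_singleton] at hs'
        rw [← hs']
        exact (Finset.mem_filter.1 hs).1
      rw [hTeq, Finset.sum_empty, abs_zero, if_neg hτT, mul_zero]
  -- the times `< τ` distributed into the windows
  have hmaps : ∀ s ∈ T', ⌊s / w⌋₊ ∈ Finset.range Kw := by
    intro s hs
    rw [Finset.mem_range]
    exact floor_div_windowLen_lt N hτ ha (Finset.mem_filter.1 hs).2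
  have hfib : ∀ k < Kw, T'.filter (fun s => ⌊s / w⌋₊ = k) = T.filter (fun s => s ∈ window N τ a k) := by
    intro k hk
    ext s
    simp only [Finset.mem_filter, hT']
    constructor
    · rintro ⟨⟨hsT, _⟩, hfl⟩
      exact ⟨hsT, (mem_window_iff N hτ ha k s).2 ⟨(hT s hsT).1, hfl⟩⟩
    · rintro ⟨hsT, hsw⟩
      exact ⟨⟨hsT, (window_subset_Ico N hτ ha hk hsw).2⟩, ((mem_window_iff N hτ ha k s).1 hsw).2⟩
  have hT'sum : ∑ s ∈ T', F s =
      ∑ k ∈ Finset.range Kw, ∑ s ∈ T.filter (fun s => s ∈ window N τ a k), F s := by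
    rw [← Finset.sum_fiberwise_of_maps_to hmaps F]
    refine Finset.sum_congr rfl fun k hk => ?_
    rw [hfib k (Finset.mem_range.1 hk)]
  -- the bound window by window
  have hwin : ∀ k ∈ Finset.range Kw,
      |∑ s ∈ T.filter (fun s => s ∈ window N τ a k), F s - h k * D k| ≤
        (η + C * θ) * D k ^ 2 + C / (θ * lam) * P k := by
    intro k hk
    have hk' := Finset.mem_range.1 hk
    set A := T.filter (fun s => s ∈ window N τ a k) with hA
    have hDk : D k = (A.card : ℝ) := hD k hk'
    have hsub : ∑ s ∈ A, F s - h k * D k = ∑ s ∈ A, (F s - h k) := by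
      rw [Finset.sum_sub_distrib, Finset.sum_const, nsmul_eq_mul, hDk, mul_comm]
    rw [hsub]
    have hDsq : D k ≤ D k ^ 2 := by
      rw [hDk]
      rcases Nat.eq_zero_or_pos A.card with h0 | hpos
      · simp [h0]
      · have h1 : (1 : ℝ) ≤ A.card := by exact_mod_cast hpos
        nlinarith
    have hPk0 := hP k
    refine (Finset.abs_sum_le_sum_abs _ _).trans ?_
    by_cases hPk : P k ≤ lam
    · calc ∑ s ∈ A, |F s - h k| ≤ ∑ s ∈ A, η := Finset.sum_le_sum fun s hs => by
              have hs' := Finset.mem_filter.1 hs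
              exact hgood k hk' s hs'.1 hs'.2 hPk
        _ = η * D k := by rw [Finset.sum_const, nsmul_eq_mul, hDk, mul_comm]
        _ ≤ η * D k ^ 2 + (C * θ * D k ^ 2 + C / (θ * lam) * P k) := by
              have h1 : η * D k ≤ η * D k ^ 2 := mul_le_mul_of_nonneg_left hDsq hη
              have h2 : 0 ≤ C * θ * D k ^ 2 + C / (θ * lam) * P k := by positivity
              linarith
        _ = (η + C * θ) * D k ^ 2 + C / (θ * lam) * P k := by ring
    · push Not at hPk
      calc ∑ s ∈ A, |F s - h k| ≤ ∑ s ∈ A, 2 * C := Finset.sum_le_sum fun s hs => by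
              have hs' := Finset.mem_filter.1 hs
              calc |F s - h k| ≤ |F s| + |h k| := abs_sub _ _
                _ ≤ C + C := add_le_add (hF s hs'.1) (hh k hk')
                _ = 2 * C := by ring
        _ = 2 * C * D k := by rw [Finset.sum_const, nsmul_eq_mul, hDk, mul_comm]
        _ ≤ 2 * C * (θ / 2 * D k ^ 2 + 1 / (2 * θ)) :=
              mul_le_mul_of_nonneg_left (le_half_mul_sq_add hθ (D k)) (by positivity)
        _ = C * θ * D k ^ 2 + C / θ * 1 := by
              field_simp
        _ ≤ C * θ * D k ^ 2 + C / θ * (P k / lam) := by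
              have h1 : (1 : ℝ) ≤ P k / lam := by rw [le_div_iff₀ hlam, one_mul]; exact hPk.le
              have h2 : 0 ≤ C / θ := by positivity
              nlinarith
        _ = (0 + C * θ) * D k ^ 2 + C / (θ * lam) * P k := by
              field_simp
              ring
        _ ≤ (η + C * θ) * D k ^ 2 + C / (θ * lam) * P k := by
              gcongr
  -- assemble
  rw [hsplit, hT'sum]
  have hre : ∑ k ∈ Finset.range Kw, ∑ s ∈ T.filter (fun s => s ∈ window N τ a k), F s + ∑ s ∈ T'', F s -
      ∑ k ∈ Finset.range Kw, h k * D k =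
      ∑ k ∈ Finset.range Kw, (∑ s ∈ T.filter (fun s => s ∈ window N τ a k), F s - h k * D k) +
        ∑ s ∈ T'', F s := by
    rw [Finset.sum_sub_distrib]
    ring
  rw [hre]
  calc |∑ k ∈ Finset.range Kw, (∑ s ∈ T.filter (fun s => s ∈ window N τ a k), F s - h k * D k) +
          ∑ s ∈ T'', F s|
      ≤ |∑ k ∈ Finset.range Kw, (∑ s ∈ T.filter (fun s => s ∈ window N τ a k), F s - h k * D k)| +
          |∑ s ∈ T'', F s| := abs_add_le _ _
    _ ≤ ∑ k ∈ Finset.range Kw, |∑ s ∈ T.filter (fun s => s ∈ window N τ a k), F s - h k * D k| +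
          C * (if τ ∈ T then 1 else 0) := add_le_add (Finset.abs_sum_le_sum_abs _ _) hτpart
    _ ≤ ∑ k ∈ Finset.range Kw, ((η + C * θ) * D k ^ 2 + C / (θ * lam) * P k) +
          C * (if τ ∈ T then 1 else 0) := by
        gcongr with k hk
        exact hwin k hk
    _ = _ := add_comm _ _

/-! ## §3 Cell geometry: centres, the coarse mollified density, the hazard weight at a window start -/

/-- **A point of the torus is within `r'` of the centre of its `r'`-cell** (`0 < r'`): in the symmetric
representative coordinates each coordinate is within `r'/2` of the cell centre, so the Euclidean distance of the
representatives is `≤ (√3/2) r' ≤ r'`, and the minimal-image distance of the projections is not larger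
(`Torus.euclidDist_proj_le_norm_sub_holds`). [folklore] -/
theorem euclidDist_cellCentre_coarseCell_le {r' : ℝ} (hr' : 0 < r') (x : T3) :
    Torus.euclidDist x (cellCentre r' (Torus.coarseCell r' x)) ≤ r' := by
  -- coordinatewise: `|y_l − (⌊y_l / r'⌋ + 1/2) r'| ≤ r'/2`
  have hcoord : ∀ l : Fin 3,
      |Torus.reprSym x l - (((Torus.coarseCell r' x l : ℤ) : ℝ) + 1 / 2) * r'| ≤ r' / 2 := by
    intro l
    unfold Torus.coarseCell
    set t : ℝ := Torus.reprSym x l / r' with ht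
    have h1 : ((⌊t⌋ : ℤ) : ℝ) ≤ t := Int.floor_le t
    have h2 : t < (⌊t⌋ : ℤ) + 1 := Int.lt_floor_add_one t
    have hy : Torus.reprSym x l = t * r' := by rw [ht]; field_simp
    rw [hy, abs_le]
    constructor <;> nlinarith
  have hsum : ∑ l, ‖(Torus.reprSym x -
      WithLp.toLp 2 fun l => (((Torus.coarseCell r' x l : ℤ) : ℝ) + 1 / 2) * r').ofLp l‖ ^ 2 ≤ r' ^ 2 := by
    calc ∑ l, ‖(Torus.reprSym x -
          WithLp.toLp 2 fun l => (((Torus.coarseCell r' x l : ℤ) : ℝ) + 1 / 2) * r').ofLp l‖ ^ 2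
        ≤ ∑ _l : Fin 3, (r' / 2) ^ 2 := by
          refine Finset.sum_le_sum fun l _ => ?_
          rw [WithLp.ofLp_sub, Pi.sub_apply, WithLp.ofLp_toLp, Real.norm_eq_abs, sq_abs]
          have h := hcoord l
          exact sq_le_sq' (by linarith [(abs_le.1 h).1]) (abs_le.1 h).2
      _ = 3 * (r' / 2) ^ 2 := by
          rw [Finset.sum_const, Finset.card_univ, Fintype.card_fin, nsmul_eq_mul, Nat.cast_ofNat]
      _ ≤ r' ^ 2 := by nlinarith
  -- `x = proj (reprSym x)` and the projection does not increase distances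
  have key : Torus.euclidDist (Literature.Analysis.FunctionSpaces.Torus.proj (Torus.reprSym x))
      (cellCentre r' (Torus.coarseCell r' x)) ≤ r' := by
    unfold cellCentre
    refine (Torus.euclidDist_proj_le_norm_sub_holds _ _).trans ?_
    rw [EuclideanSpace.norm_eq]
    calc √(∑ l, ‖(Torus.reprSym x -
          WithLp.toLp 2 fun l => (((Torus.coarseCell r' x l : ℤ) : ℝ) + 1 / 2) * r').ofLp l‖ ^ 2)
        ≤ √(r' ^ 2) := Real.sqrt_le_sqrt hsum
      _ = r' := Real.sqrt_sq hr'.le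
  rwa [Torus.proj_reprSym] at key

/-- The coarse mollified density is the mollified density, read at the centre of the cell of sphere `i`, of the
configuration of cell centres (any velocities). [folklore] -/
theorem coarseMollDensity_eq_mollDensity (N : ℕ) (r r' : ℝ) (c : Fin (N + 1) → (Fin 3 → ℤ)) (i : Fin (N + 1)) :
    coarseMollDensity N r r' c i =
      mollDensity r (fun j => (cellCentre r' (c j), (0 : V3))) (cellCentre r' (c i)) := by
  unfold coarseMollDensity mollDensity
  rw [integral_empiricalMeasure]

/-- The coarse mollified density is at most the peak value `3/(πr³)` of the cone kernel (`0 < r`). [folklore] -/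
theorem coarseMollDensity_le (N : ℕ) {r : ℝ} (hr : 0 < r) (r' : ℝ) (c : Fin (N + 1) → (Fin 3 → ℤ))
    (i : Fin (N + 1)) : coarseMollDensity N r r' c i ≤ 3 / (Real.pi * r ^ 3) := by
  rw [coarseMollDensity_eq_mollDensity]
  exact mollDensity_le hr _ _

/-- The hazard weight read on the coarse state at the start of window `k < Kw`, unfolded: `χ` at the window start
and the centre of the cell of `x_i(kw)`, `g` at `σ³` times the coarse mollified density of the cells of all spheres at
time `kw`. [folklore] -/
theorem hazardWeight_coarseStateAt_eq (σ : ℝ) (N : ℕ)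
    (Φ : HardSphereFlow (Torus.geometry (Fin 3)) (hsDiameter σ N) (N + 1)) (χ : ℝ × T3 → ℝ) (g : ℝ → ℝ)
    (r r' τ a : ℝ) (i : Fin (N + 1)) {k : ℕ} (hk : k < windowNum N τ a) (z : Config (N + 1) (Fin 3) T3) :
    hazardWeight σ N χ g r r' τ a i k (coarseStateAt σ N Φ r' τ a k z) =
      χ ((k : ℝ) * windowLen N τ a,
          cellCentre r' (Torus.coarseCell r' (Φ.flow ((k : ℝ) * windowLen N τ a) z i).1)) *
        g (σ ^ 3 * coarseMollDensity N r r'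
          (fun j => Torus.coarseCell r' (Φ.flow ((k : ℝ) * windowLen N τ a) z j).1) i) := by
  unfold hazardWeight hazardWeightCells
  rw [if_pos hk]
  rfl

/-! ## §4 Binary collisions: at most two spheres participate at any time -/

/-- **At most two spheres participate in a collision at any given time** along a hard-sphere trajectory in a
geometry with binary collisions: off the collision times nobody participates, at a collision time exactly the two
spheres of a colliding pair do (`IsHardSphereTrajectory.participates_iff`). [cite: GST2013, §4.1] -/
theorem sum_ite_participates_le_two {d X : Type*} [Fintype d] [TopologicalSpace X] {M : ℕ}
    {G : Geometry d X} {ε : ℝ} {γ : ℝ → Config M d X} (hγ : IsHardSphereTrajectory G ε M γ) (t : ℝ) :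
    ∑ i, (if Participates G ε (γ t) i then (1 : ℝ) else 0) ≤ 2 := by
  classical
  rw [Finset.sum_boole]
  by_cases ht : t ∈ collisionTimes G ε γ
  · obtain ⟨⟨p, q⟩, hpq⟩ := mem_collisionTimes_iff_contactPairs_nonempty.1 ht
    have hfilter : Finset.univ.filter (fun i => Participates G ε (γ t) i) = {p, q} := by
      ext i
      simp only [Finset.mem_filter, Finset.mem_univ, true_and, Finset.mem_insert, Finset.mem_singleton,
        hγ.participates_iff hpq]
    rw [hfilter]
    exact_mod_cast Finset.card_le_two
  · have hfilter : Finset.univ.filter (fun i => Participates G ε (γ t) i) = ∅ := by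
      refine Finset.eq_empty_of_forall_notMem fun i hi => ht ?_
      exact mem_collisionTimes_iff_exists_participates.2 ⟨i, (Finset.mem_filter.1 hi).2⟩
    rw [hfilter, Finset.card_empty, Nat.cast_zero]
    norm_num

/-! ## §5 Path lengths and energy along a good orbit -/

/-- The window path lengths of one sphere add up to its path length over `[0, τ]`:
`Σ_{k<Kw} ∫_{kw}^{(k+1)w} ‖v_i‖ = ∫₀^τ ‖v_i‖` (adjacent intervals, `Kw · w = τ`; the windows are those of
`windowNum M τ a`, `windowLen M τ a` for any label `M`). [folklore] -/
theorem sum_range_integral_norm_vel_window {d : Type*} [Fintype d] {ε : ℝ} {n : ℕ}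
    (Φ : HardSphereFlow (Torus.geometry d) ε n) {z : Config n d (UnitAddTorus d)} (hz : z ∈ Φ.good) (i : Fin n)
    (M : ℕ) {τ a : ℝ} (hτ : 0 < τ) (ha : 0 < a) :
    ∑ k ∈ Finset.range (windowNum M τ a),
        ∫ u in ((k : ℝ) * windowLen M τ a)..(((k : ℝ) + 1) * windowLen M τ a), ‖(Φ.flow u z i).2‖ =
      ∫ u in (0 : ℝ)..τ, ‖(Φ.flow u z i).2‖ := by
  have h := intervalIntegral.sum_integral_adjacent_intervals (f := fun u => ‖(Φ.flow u z i).2‖) (μ := volume)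
    (a := fun k : ℕ => (k : ℝ) * windowLen M τ a) (n := windowNum M τ a)
    (fun k _ => Φ.intervalIntegrable_norm_vel_flow hz i _ _)
  simp only [Nat.cast_zero, zero_mul, Nat.cast_add, Nat.cast_one] at h
  rw [windowNum_mul_windowLen M hτ ha] at h
  exact h

/-- **Total path length against energy**: along a good orbit, for `t₁ ≤ t₂`,
`Σ_i ∫_{t₁}^{t₂} ‖v_i‖ ≤ (t₂ − t₁) (N/2 + E(z))` — pointwise `‖v‖ ≤ ½ + ½‖v‖²` and `Σ_i ‖v_i(u)‖² = 2E(z)` by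
conservation of energy (`HardSphereFlow.configEnergy_flow`). [folklore] -/
theorem sum_integral_norm_vel_le {d : Type*} [Fintype d] {ε : ℝ} {n : ℕ}
    (Φ : HardSphereFlow (Torus.geometry d) ε n) {z : Config n d (UnitAddTorus d)} (hz : z ∈ Φ.good)
    {t₁ t₂ : ℝ} (h12 : t₁ ≤ t₂) :
    ∑ i, ∫ u in t₁..t₂, ‖(Φ.flow u z i).2‖ ≤ (t₂ - t₁) * ((n : ℝ) / 2 + configEnergy z) := by
  have hpt : ∀ u, ∑ i, (1 / 2 + ‖(Φ.flow u z i).2‖ ^ 2 / 2) = (n : ℝ) / 2 + configEnergy z := by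
    intro u
    rw [Finset.sum_add_distrib, Finset.sum_const, Finset.card_univ, Fintype.card_fin, nsmul_eq_mul,
      ← Finset.sum_div, ← Φ.configEnergy_flow hz u]
    simp only [configEnergy]
    ring
  have hint : ∀ i, IntervalIntegrable (fun u => 1 / 2 + ‖(Φ.flow u z i).2‖ ^ 2 / 2) volume t₁ t₂ := fun i =>
    intervalIntegrable_const.add ((Φ.intervalIntegrable_norm_vel_sq_flow hz i t₁ t₂).div_const 2)
  calc ∑ i, ∫ u in t₁..t₂, ‖(Φ.flow u z i).2‖
      ≤ ∑ i, ∫ u in t₁..t₂, (1 / 2 + ‖(Φ.flow u z i).2‖ ^ 2 / 2) := by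
        refine Finset.sum_le_sum fun i _ => ?_
        refine intervalIntegral.integral_mono_on h12 (Φ.intervalIntegrable_norm_vel_flow hz i t₁ t₂) (hint i) ?_
        intro u _
        nlinarith [sq_nonneg (‖(Φ.flow u z i).2‖ - 1)]
    _ = ∫ u in t₁..t₂, ∑ i, (1 / 2 + ‖(Φ.flow u z i).2‖ ^ 2 / 2) :=
        (intervalIntegral.integral_finsetSum fun i _ => hint i).symm
    _ = ∫ u in t₁..t₂, ((n : ℝ) / 2 + configEnergy z) := by simp_rw [hpt]
    _ = (t₂ - t₁) * ((n : ℝ) / 2 + configEnergy z) := by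
        rw [intervalIntegral.integral_const, smul_eq_mul]

/-- The mean window path length is small with the window: along a good orbit, for `t₁ ≤ t₂`,
`n⁻¹ Σ_i ∫_{t₁}^{t₂} ‖v_i‖ ≤ (t₂ − t₁)(1/2 + n⁻¹ E(z))` (`n ≥ 1` spheres). [folklore] -/
theorem inv_mul_sum_integral_norm_vel_le {d : Type*} [Fintype d] {ε : ℝ} {n : ℕ}
    (Φ : HardSphereFlow (Torus.geometry d) ε n) {z : Config n d (UnitAddTorus d)} (hz : z ∈ Φ.good)
    (hn : 0 < n) {t₁ t₂ : ℝ} (h12 : t₁ ≤ t₂) :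
    (n : ℝ)⁻¹ * ∑ i, ∫ u in t₁..t₂, ‖(Φ.flow u z i).2‖ ≤ (t₂ - t₁) * (1 / 2 + (n : ℝ)⁻¹ * configEnergy z) := by
  have hn' : (0 : ℝ) < n := by exact_mod_cast hn
  calc (n : ℝ)⁻¹ * ∑ i, ∫ u in t₁..t₂, ‖(Φ.flow u z i).2‖
      ≤ (n : ℝ)⁻¹ * ((t₂ - t₁) * ((n : ℝ) / 2 + configEnergy z)) :=
        mul_le_mul_of_nonneg_left (sum_integral_norm_vel_le Φ hz h12) (by positivity)
    _ = (t₂ - t₁) * (1 / 2 + (n : ℝ)⁻¹ * configEnergy z) := by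
        field_simp

/-! ## §6 The frozen-weight estimate on a good window -/

/-- `|χ₁ g₁ − χ₂ g₂| ≤ |χ₁ − χ₂| |g₁| + |χ₂| |g₁ − g₂|`. [folklore] -/
theorem abs_mul_sub_mul_le_abs (χ₁ χ₂ g₁ g₂ : ℝ) :
    |χ₁ * g₁ - χ₂ * g₂| ≤ |χ₁ - χ₂| * |g₁| + |χ₂| * |g₁ - g₂| := by
  have : χ₁ * g₁ - χ₂ * g₂ = (χ₁ - χ₂) * g₁ + χ₂ * (g₁ - g₂) := by ring
  rw [this, ← abs_mul, ← abs_mul]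
  exact abs_add_le _ _

/-- **The frozen-weight estimate on a good window.**  Along a good orbit, fix a window `k < Kw` with start
`t₀ = kw` and a time `s` in it, and suppose the path length of sphere `i` over the window is `≤ λ`.  Then the
collision weight `χ(s, x_i(s)) g(σ³ρ_r(Φ_s z, x_i(s)))` differs from the hazard weight
`h*_{i,k} = χ(t₀, c_i) g(σ³ρ̃_r)` frozen at the window start (`c_j` the centre of the `r'`-cell of `x_j(t₀)`,
`ρ̃_r = (N+1)⁻¹ Σ_j b_r(c_j, c_i)`) by at most `C_g η' + C_χ η'`, provided `η'`-moduli `λ_χ` of `χ` on `[0,τ] × 𝕋³` and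
`λ_g` of `g` on `[0, σ³ · 3/(πr³)]` dominate the displacements: `|s − t₀| ≤ w ≤ λ_χ`;
`dist(x_i(s), c_i) ≤ λ + r' ≤ λ_χ` (path length, and a point is within `r'` of its cell centre); and
`σ³ |ρ_r(Φ_s z, x_i(s)) − ρ̃_r| ≤ σ³ (3/(πr⁴)) (w(½ + E/(N+1)) + λ + 2r') ≤ λ_g` (the mollified density is
`3/(πr⁴)`-Lipschitz in the mean displacement of all spheres, `≤ w(½ + E/(N+1))` by `‖v‖ ≤ ½ + ½‖v‖²` and energy
conservation, and in the point). [cite: CIPDiluteGases1994, App. 4.A] -/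
theorem abs_weight_sub_hazardWeight_le (σ : ℝ) (N : ℕ)
    (Φ : HardSphereFlow (Torus.geometry (Fin 3)) (hsDiameter σ N) (N + 1)) {z : Config (N + 1) (Fin 3) T3}
    (hz : z ∈ Φ.good) (hσ : 0 ≤ σ) {τ a r r' : ℝ} (hτ : 0 < τ) (ha : 0 < a) (hr : 0 < r) (hr' : 0 < r')
    (χ : ℝ × T3 → ℝ) (g : ℝ → ℝ) {Cχ Cg η' lχ lg KE lam : ℝ}
    (hCg : ∀ x, 0 ≤ x → |g x| ≤ Cg) (hCχ : ∀ p : ℝ × T3, p.1 ∈ Icc 0 τ → |χ p| ≤ Cχ)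
    (hχmod : ∀ p q : ℝ × T3, p.1 ∈ Icc 0 τ → q.1 ∈ Icc 0 τ → dist p q ≤ lχ → |χ p - χ q| ≤ η')
    (hgmod : ∀ x y : ℝ, x ∈ Icc 0 (σ ^ 3 * (3 / (Real.pi * r ^ 3))) →
      y ∈ Icc 0 (σ ^ 3 * (3 / (Real.pi * r ^ 3))) → |x - y| ≤ lg → |g x - g y| ≤ η')
    (hE : ((N : ℝ) + 1)⁻¹ * configEnergy z ≤ KE)
    (hw : windowLen N τ a ≤ lχ) (hlr : lam + r' ≤ lχ)
    (hdens : σ ^ 3 * (3 / (Real.pi * r ^ 4)) * (windowLen N τ a * (1 / 2 + KE) + lam + 2 * r') ≤ lg)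
    {i : Fin (N + 1)} {k : ℕ} (hk : k < windowNum N τ a) {s : ℝ} (hs : s ∈ window N τ a k)
    (hP : ∫ u in ((k : ℝ) * windowLen N τ a)..(((k : ℝ) + 1) * windowLen N τ a), ‖(Φ.flow u z i).2‖ ≤ lam) :
    |χ (s, (Φ.flow s z i).1) * g (σ ^ 3 * mollDensity r (Φ.flow s z) (Φ.flow s z i).1) -
        hazardWeight σ N χ g r r' τ a i k (coarseStateAt σ N Φ r' τ a k z)| ≤ Cg * η' + Cχ * η' := by
  rw [hazardWeight_coarseStateAt_eq σ N Φ χ g r r' τ a i hk z]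
  set w := windowLen N τ a with hw_def
  set t₀ : ℝ := (k : ℝ) * w with ht₀
  have hwpos : 0 < w := windowLen_pos N hτ ha
  have ht₀mem : t₀ ∈ Icc (0 : ℝ) τ := windowStart_mem_Icc N hτ ha hk
  have hsIcc : s ∈ Icc (0 : ℝ) τ := Ico_subset_Icc_self (window_subset_Ico N hτ ha hk hs)
  have hs' : s ∈ Icc t₀ (((k : ℝ) + 1) * w) := ⟨hs.1, hs.2.le⟩
  have hst₀ : t₀ ≤ s := hs.1
  have hsw : s - t₀ ≤ w := by
    have h2 : s < ((k : ℝ) + 1) * w := hs.2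
    rw [ht₀]; linarith
  have h01 : t₀ ≤ ((k : ℝ) + 1) * w := by rw [ht₀]; nlinarith
  -- displacements inside the window are bounded by the window path lengths
  have hdisp : ∀ j, Torus.euclidDist (Φ.flow s z j).1 (Φ.flow t₀ z j).1 ≤
      ∫ u in t₀..(((k : ℝ) + 1) * w), ‖(Φ.flow u z j).2‖ :=
    fun j => Φ.euclidDist_flow_le_integral_norm_vel_of_mem_Icc hz j hs'
  -- distance of every sphere at time `s` to the centre of its cell at time `t₀`
  have hcen : ∀ j, Torus.euclidDist (Φ.flow s z j).1
      (cellCentre r' (Torus.coarseCell r' (Φ.flow t₀ z j).1)) ≤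
      (∫ u in t₀..(((k : ℝ) + 1) * w), ‖(Φ.flow u z j).2‖) + r' :=
    fun j => (euclidDist_triangle _ (Φ.flow t₀ z j).1 _).trans
      (add_le_add (hdisp j) (euclidDist_cellCentre_coarseCell_le hr' _))
  have hdi : Torus.euclidDist (Φ.flow s z i).1
      (cellCentre r' (Torus.coarseCell r' (Φ.flow t₀ z i).1)) ≤ lam + r' :=
    (hcen i).trans (add_le_add hP le_rfl)
  -- the mean distance to the cell centres
  have hmean : ((N + 1 : ℕ) : ℝ)⁻¹ * ∑ j, Torus.euclidDist (Φ.flow s z j).1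
      (cellCentre r' (Torus.coarseCell r' (Φ.flow t₀ z j).1)) ≤ w * (1 / 2 + KE) + r' := by
    have h2 := inv_mul_sum_integral_norm_vel_le Φ hz (Nat.succ_pos N) h01
    have h3 : ((k : ℝ) + 1) * w - t₀ = w := by rw [ht₀]; ring
    rw [h3] at h2
    have hE' : ((N + 1 : ℕ) : ℝ)⁻¹ * configEnergy z ≤ KE := by push_cast; exact hE
    have hNinv : 0 ≤ ((N + 1 : ℕ) : ℝ)⁻¹ := by positivity
    calc ((N + 1 : ℕ) : ℝ)⁻¹ * ∑ j, Torus.euclidDist (Φ.flow s z j).1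
          (cellCentre r' (Torus.coarseCell r' (Φ.flow t₀ z j).1))
        ≤ ((N + 1 : ℕ) : ℝ)⁻¹ * ∑ j, ((∫ u in t₀..(((k : ℝ) + 1) * w), ‖(Φ.flow u z j).2‖) + r') :=
          mul_le_mul_of_nonneg_left (Finset.sum_le_sum fun j _ => hcen j) hNinv
      _ = ((N + 1 : ℕ) : ℝ)⁻¹ * ∑ j, (∫ u in t₀..(((k : ℝ) + 1) * w), ‖(Φ.flow u z j).2‖) + r' := by
          rw [Finset.sum_add_distrib, Finset.sum_const, Finset.card_univ, Fintype.card_fin, nsmul_eq_mul,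
            mul_add, ← mul_assoc _ (((N + 1 : ℕ) : ℝ)) r', inv_mul_cancel₀ (by positivity), one_mul]
      _ ≤ w * (1 / 2 + ((N + 1 : ℕ) : ℝ)⁻¹ * configEnergy z) + r' := by linarith [h2]
      _ ≤ w * (1 / 2 + KE) + r' := by nlinarith [hwpos.le, hE']
  -- the density read at the cell centres
  have hρ : |mollDensity r (Φ.flow s z) (Φ.flow s z i).1 -
      coarseMollDensity N r r' (fun j => Torus.coarseCell r' (Φ.flow t₀ z j).1) i| ≤
      3 / (Real.pi * r ^ 4) * (w * (1 / 2 + KE) + lam + 2 * r') := by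
    rw [coarseMollDensity_eq_mollDensity]
    refine (abs_mollDensity_sub_le hr _ _ _ _).trans ?_
    refine mul_le_mul_of_nonneg_left ?_ (by positivity)
    dsimp only
    linarith [hmean, hdi]
  -- the `χ` factor
  have hχ : |χ (s, (Φ.flow s z i).1) -
      χ (t₀, cellCentre r' (Torus.coarseCell r' (Φ.flow t₀ z i).1))| ≤ η' := by
    refine hχmod (s, (Φ.flow s z i).1) (t₀, cellCentre r' (Torus.coarseCell r' (Φ.flow t₀ z i).1))
      hsIcc ht₀mem ?_
    rw [Prod.dist_eq]
    refine max_le ?_ ?_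
    · rw [Real.dist_eq, abs_of_nonneg (sub_nonneg.2 hst₀)]
      exact hsw.trans hw
    · rw [dist_eq_norm]
      exact ((Torus.norm_sub_le_euclidDist_holds _ _).trans hdi).trans hlr
  -- the `g` factor
  have hM : ∀ ρ, 0 ≤ ρ → ρ ≤ 3 / (Real.pi * r ^ 3) → σ ^ 3 * ρ ∈ Icc 0 (σ ^ 3 * (3 / (Real.pi * r ^ 3))) :=
    fun ρ h0 h1 => ⟨mul_nonneg (pow_nonneg hσ 3) h0, mul_le_mul_of_nonneg_left h1 (pow_nonneg hσ 3)⟩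
  have hg : |g (σ ^ 3 * mollDensity r (Φ.flow s z) (Φ.flow s z i).1) -
      g (σ ^ 3 * coarseMollDensity N r r' (fun j => Torus.coarseCell r' (Φ.flow t₀ z j).1) i)| ≤ η' := by
    refine hgmod _ _ (hM _ (mollDensity_nonneg hr _ _) (mollDensity_le hr _ _))
      (hM _ (coarseMollDensity_nonneg N hr r' _ i) (coarseMollDensity_le N hr r' _ i)) ?_
    rw [← mul_sub, abs_mul, abs_of_nonneg (pow_nonneg hσ 3)]
    calc σ ^ 3 * |mollDensity r (Φ.flow s z) (Φ.flow s z i).1 -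
          coarseMollDensity N r r' (fun j => Torus.coarseCell r' (Φ.flow t₀ z j).1) i|
        ≤ σ ^ 3 * (3 / (Real.pi * r ^ 4) * (w * (1 / 2 + KE) + lam + 2 * r')) :=
          mul_le_mul_of_nonneg_left hρ (pow_nonneg hσ 3)
      _ ≤ lg := by rw [← mul_assoc]; exact hdens
  -- combine
  have hη' : 0 ≤ η' := (abs_nonneg _).trans hχ
  have hg₁ : |g (σ ^ 3 * mollDensity r (Φ.flow s z) (Φ.flow s z i).1)| ≤ Cg :=
    hCg _ (mul_nonneg (pow_nonneg hσ 3) (mollDensity_nonneg hr _ _))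
  have hχ₂ : |χ (t₀, cellCentre r' (Torus.coarseCell r' (Φ.flow t₀ z i).1))| ≤ Cχ := hCχ _ ht₀mem
  have hCχ0 : 0 ≤ Cχ := (abs_nonneg _).trans hχ₂
  refine (abs_mul_sub_mul_le_abs _ _ _ _).trans ?_
  calc _ ≤ η' * Cg + Cχ * η' :=
        add_le_add (mul_le_mul hχ hg₁ (abs_nonneg _) hη') (mul_le_mul hχ₂ hg (abs_nonneg _) hCχ0)
    _ = Cg * η' + Cχ * η' := by ring

/-! ## §7 The pathwise window bookkeeping bound along a good orbit -/

/-- **The pathwise window bookkeeping bound.**  Along a good orbit of `N + 1` spheres of diameter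
`ε = hsDiameter σ N` (`0 < σ < 1/2`), compare the particle-indexed collision sum
`(ε/(N+1)) Σ_i Σ_{s ∈ CT_i ∩ [0,τ]} F_i(s)` with the window sum `WS(h, D) = (ε/(N+1)) Σ_i Σ_{k<Kw} h_{i,k}(p_k) D_{i,k}`
of weights read on the coarse states at the window starts against the windowed collision counts: if `|F_i| ≤ C` on
`[0, τ]`, `|h_{i,k}(p_k)| ≤ C`, and `|F_i(s) − h_{i,k}(p_k)| ≤ η` for every time `s` of a window `k` over which the path
length of sphere `i` is `≤ λ`, then for every `θ > 0`
`|Σ − WS| ≤ 2Cε + (η + Cθ) · (ε/(N+1)) Σ_{i,k} D_{i,k}² + (C/(θλ)) · ε τ (½ + E/(N+1))`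
— the abstract inequality `abs_sum_sub_sum_mul_le` sphere by sphere (the collision times of one sphere in `[0, τ]`
are finitely many on the good set), at most two spheres colliding at the time `τ` itself, and the window path
lengths adding up to `Σ_i ∫₀^τ ‖v_i‖ ≤ τ((N+1)/2 + E)`. [cite: CIPDiluteGases1994, App. 4.A] -/
theorem abs_particleSum_sub_windowSum_le (σ : ℝ) (N : ℕ)
    (Φ : HardSphereFlow (Torus.geometry (Fin 3)) (hsDiameter σ N) (N + 1)) {z : Config (N + 1) (Fin 3) T3}
    (hz : z ∈ Φ.good) (hσ : 0 < σ) {τ a : ℝ} (hτ : 0 < τ) (ha : 0 < a) (r' : ℝ)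
    (F : Fin (N + 1) → ℝ → ℝ) (h : Fin (N + 1) → ℕ → CoarseState N → ℝ) {C η θ lam : ℝ} (hC : 0 ≤ C)
    (hη : 0 ≤ η) (hθ : 0 < θ) (hlam : 0 < lam)
    (hF : ∀ i, ∀ s ∈ Icc 0 τ, |F i s| ≤ C)
    (hh : ∀ i, ∀ k < windowNum N τ a, |h i k (coarseStateAt σ N Φ r' τ a k z)| ≤ C)
    (hgood : ∀ i, ∀ k < windowNum N τ a, ∀ s ∈ window N τ a k,
      (∫ u in ((k : ℝ) * windowLen N τ a)..(((k : ℝ) + 1) * windowLen N τ a), ‖(Φ.flow u z i).2‖) ≤ lam →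
      |F i s - h i k (coarseStateAt σ N Φ r' τ a k z)| ≤ η) :
    |hsDiameter σ N / (N + 1 : ℝ) * ∑ i : Fin (N + 1),
        ∑ᶠ s ∈ collisionTimesOf (Torus.geometry (Fin 3)) (hsDiameter σ N) (fun u => Φ.flow u z) i ∩ Icc 0 τ,
          F i s -
      windowSum σ N Φ r' τ a h (windowCollisions σ N Φ τ a) z| ≤
      2 * C * hsDiameter σ N +
      (η + C * θ) * (hsDiameter σ N / (N + 1 : ℝ) *
        ∑ i : Fin (N + 1), ∑ k ∈ Finset.range (windowNum N τ a), windowCollisions σ N Φ τ a i k z ^ 2) +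
      C / (θ * lam) * (hsDiameter σ N * τ * (1 / 2 + ((N : ℝ) + 1)⁻¹ * configEnergy z)) := by
  classical
  set Kw := windowNum N τ a with hKw
  set w := windowLen N τ a with hw_def
  have hε : 0 ≤ (hsDiameter σ N) := (hsDiameter_pos hσ N).le
  have hN1 : (0 : ℝ) < (N : ℝ) + 1 := by positivity
  have hwpos : 0 < w := windowLen_pos N hτ ha
  have htraj := Φ.isTrajectory z hz
  -- the finite sets of collision times of each sphere in `[0, τ]`
  have hfin : ∀ i, (collisionTimesOf (Torus.geometry (Fin 3)) (hsDiameter σ N) (fun u => Φ.flow u z) i ∩ Icc 0 τ).Finite :=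
    fun i => (htraj.locFinite 0 τ).subset (inter_subset_inter_left _ (collisionTimesOf_subset _ i))
  set T : Fin (N + 1) → Finset ℝ := fun i => (hfin i).toFinset with hT
  have hTmem : ∀ i s, s ∈ T i ↔
      s ∈ collisionTimesOf (Torus.geometry (Fin 3)) (hsDiameter σ N) (fun u => Φ.flow u z) i ∧ s ∈ Icc 0 τ :=
    fun i s => Set.Finite.mem_toFinset _
  have hfs : ∀ i,
      ∑ᶠ s ∈ collisionTimesOf (Torus.geometry (Fin 3)) (hsDiameter σ N) (fun u => Φ.flow u z) i ∩ Icc 0 τ, F i s =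
        ∑ s ∈ T i, F i s := fun i => finsum_mem_eq_finite_toFinset_sum _ (hfin i)
  -- the window counts are the cardinalities of the window fibres
  have hD : ∀ i, ∀ k < Kw, windowCollisions σ N Φ τ a i k z =
      (((T i).filter fun s => s ∈ window N τ a k).card : ℝ) := by
    intro i k hk
    rw [windowCollisions, if_pos hz]
    congr 1
    rw [← Set.ncard_coe_finset]
    congr 1
    ext s
    rw [Finset.coe_filter, Set.mem_setOf_eq, hTmem, Set.mem_inter_iff]
    constructor
    · rintro ⟨h1, h2⟩
      exact ⟨⟨h1, Ico_subset_Icc_self (window_subset_Ico N hτ ha hk h2)⟩, h2⟩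
    · rintro ⟨⟨h1, _⟩, h2⟩
      exact ⟨h1, h2⟩
  -- window path lengths
  set P : Fin (N + 1) → ℕ → ℝ := fun i k =>
    ∫ u in ((k : ℝ) * w)..(((k : ℝ) + 1) * w), ‖(Φ.flow u z i).2‖ with hP_def
  have hP : ∀ i k, 0 ≤ P i k := fun i k =>
    Φ.integral_norm_vel_flow_nonneg z i (by nlinarith [hwpos.le])
  -- the abstract inequality, sphere by sphere
  have hpp : ∀ i, |∑ s ∈ T i, F i s -
      ∑ k ∈ Finset.range Kw, h i k (coarseStateAt σ N Φ r' τ a k z) * windowCollisions σ N Φ τ a i k z| ≤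
      C * (if τ ∈ T i then 1 else 0) +
        ∑ k ∈ Finset.range Kw,
          ((η + C * θ) * windowCollisions σ N Φ τ a i k z ^ 2 + C / (θ * lam) * P i k) :=
    fun i => abs_sum_sub_sum_mul_le N hτ ha (fun s hs => ((hTmem i s).1 hs).2) (F i)
      (fun k => h i k (coarseStateAt σ N Φ r' τ a k z)) (P i) (fun k => windowCollisions σ N Φ τ a i k z)
      hC hη hθ hlam (hP i) (hD i) (fun s hs => hF i s ((hTmem i s).1 hs).2) (hh i)
      (fun k hk s _ hsw hPk => hgood i k hk s hsw hPk)
  -- at most two spheres collide at the time `τ`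
  have hS₁ : ∑ i : Fin (N + 1), (if τ ∈ T i then (1 : ℝ) else 0) ≤ 2 := by
    have hiff : ∀ i, (τ ∈ T i ↔ Participates (Torus.geometry (Fin 3)) (hsDiameter σ N) (Φ.flow τ z) i) := by
      intro i
      rw [hTmem, mem_collisionTimesOf]
      exact ⟨fun h => h.1, fun h => ⟨h, ⟨hτ.le, le_rfl⟩⟩⟩
    simp_rw [hiff]
    exact sum_ite_participates_le_two htraj τ
  -- the window path lengths add up to `Σ_i ∫₀^τ ‖v_i‖ ≤ τ ((N+1)/2 + E)`
  have hS₃ : ∑ i : Fin (N + 1), ∑ k ∈ Finset.range Kw, P i k ≤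
      τ * (((N + 1 : ℕ) : ℝ) / 2 + configEnergy z) := by
    have h1 : ∀ i, ∑ k ∈ Finset.range Kw, P i k = ∫ u in (0 : ℝ)..τ, ‖(Φ.flow u z i).2‖ :=
      fun i => sum_range_integral_norm_vel_window Φ hz i N hτ ha
    have h2 := sum_integral_norm_vel_le Φ hz hτ.le
    rw [sub_zero] at h2
    rw [Finset.sum_congr rfl fun i _ => h1 i]
    exact h2
  -- assemble
  have hws : windowSum σ N Φ r' τ a h (windowCollisions σ N Φ τ a) z = (hsDiameter σ N) / (N + 1 : ℝ) *
      ∑ i, ∑ k ∈ Finset.range Kw, h i k (coarseStateAt σ N Φ r' τ a k z) * windowCollisions σ N Φ τ a i k z :=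
    rfl
  rw [hws, Finset.sum_congr rfl fun i _ => hfs i, ← mul_sub, ← Finset.sum_sub_distrib, abs_mul,
    abs_of_nonneg (by positivity : 0 ≤ (hsDiameter σ N) / (N + 1 : ℝ))]
  have halg : ∑ i : Fin (N + 1), (C * (if τ ∈ T i then (1 : ℝ) else 0) +
      ∑ k ∈ Finset.range Kw, ((η + C * θ) * windowCollisions σ N Φ τ a i k z ^ 2 + C / (θ * lam) * P i k)) =
      C * ∑ i : Fin (N + 1), (if τ ∈ T i then (1 : ℝ) else 0) +
      (η + C * θ) * ∑ i : Fin (N + 1), ∑ k ∈ Finset.range Kw, windowCollisions σ N Φ τ a i k z ^ 2 +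
      C / (θ * lam) * ∑ i : Fin (N + 1), ∑ k ∈ Finset.range Kw, P i k := by
    simp only [Finset.sum_add_distrib, Finset.mul_sum]
    ring
  have e1 : (hsDiameter σ N) / (N + 1 : ℝ) * (C * ∑ i : Fin (N + 1), (if τ ∈ T i then (1 : ℝ) else 0)) ≤ 2 * C * (hsDiameter σ N) := by
    have h1 : (hsDiameter σ N) / (N + 1 : ℝ) ≤ (hsDiameter σ N) := div_le_self hε (by linarith)
    calc (hsDiameter σ N) / (N + 1 : ℝ) * (C * ∑ i : Fin (N + 1), (if τ ∈ T i then (1 : ℝ) else 0))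
        ≤ (hsDiameter σ N) * (C * 2) := mul_le_mul h1 (mul_le_mul_of_nonneg_left hS₁ hC) (by positivity) hε
      _ = 2 * C * (hsDiameter σ N) := by ring
  have e3 : (hsDiameter σ N) / (N + 1 : ℝ) * ∑ i : Fin (N + 1), ∑ k ∈ Finset.range Kw, P i k ≤
      (hsDiameter σ N) * τ * (1 / 2 + ((N : ℝ) + 1)⁻¹ * configEnergy z) := by
    calc (hsDiameter σ N) / (N + 1 : ℝ) * ∑ i : Fin (N + 1), ∑ k ∈ Finset.range Kw, P i k
        ≤ (hsDiameter σ N) / (N + 1 : ℝ) * (τ * (((N + 1 : ℕ) : ℝ) / 2 + configEnergy z)) :=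
          mul_le_mul_of_nonneg_left hS₃ (by positivity)
      _ = (hsDiameter σ N) * τ * (1 / 2 + ((N : ℝ) + 1)⁻¹ * configEnergy z) := by
          push_cast
          field_simp
  calc (hsDiameter σ N) / (N + 1 : ℝ) * |∑ i, (∑ s ∈ T i, F i s -
          ∑ k ∈ Finset.range Kw, h i k (coarseStateAt σ N Φ r' τ a k z) * windowCollisions σ N Φ τ a i k z)|
      ≤ (hsDiameter σ N) / (N + 1 : ℝ) * ∑ i : Fin (N + 1), (C * (if τ ∈ T i then (1 : ℝ) else 0) +
          ∑ k ∈ Finset.range Kw,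
            ((η + C * θ) * windowCollisions σ N Φ τ a i k z ^ 2 + C / (θ * lam) * P i k)) :=
        mul_le_mul_of_nonneg_left
          ((Finset.abs_sum_le_sum_abs _ _).trans (Finset.sum_le_sum fun i _ => hpp i)) (by positivity)
    _ = (hsDiameter σ N) / (N + 1 : ℝ) * (C * ∑ i : Fin (N + 1), (if τ ∈ T i then (1 : ℝ) else 0)) +
        (η + C * θ) * ((hsDiameter σ N) / (N + 1 : ℝ) *
          ∑ i : Fin (N + 1), ∑ k ∈ Finset.range Kw, windowCollisions σ N Φ τ a i k z ^ 2) +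
        C / (θ * lam) * ((hsDiameter σ N) / (N + 1 : ℝ) * ∑ i : Fin (N + 1), ∑ k ∈ Finset.range Kw, P i k) := by
        rw [halg]
        ring
    _ ≤ 2 * C * (hsDiameter σ N) +
        (η + C * θ) * ((hsDiameter σ N) / (N + 1 : ℝ) *
          ∑ i : Fin (N + 1), ∑ k ∈ Finset.range Kw, windowCollisions σ N Φ τ a i k z ^ 2) +
        C / (θ * lam) * ((hsDiameter σ N) * τ * (1 / 2 + ((N : ℝ) + 1)⁻¹ * configEnergy z)) :=
        add_le_add (add_le_add e1 le_rfl) (mul_le_mul_of_nonneg_left e3 (by positivity))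

/-! ## §8 The vanishing of `(N+1)^{-1/3}` -/

/-- `(N+1)^{-1/3} ≤ c` for all large `N` (`c > 0`): the `∃ N₀ ∀ N ≥ N₀` form of `tendsto_hsDiameter` at `σ = 1`.
[folklore] -/
theorem exists_nat_rpow_neg_third_le {c : ℝ} (hc : 0 < c) :
    ∃ N₀ : ℕ, ∀ N : ℕ, N₀ ≤ N → ((N + 1 : ℕ) : ℝ) ^ (-(1 / 3 : ℝ)) ≤ c := by
  have h : ∀ᶠ N in atTop, hsDiameter 1 N ∈ Iic c := (tendsto_hsDiameter 1).eventually (Iic_mem_nhds hc)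
  obtain ⟨N₀, hN₀⟩ := Filter.eventually_atTop.1 h
  refine ⟨N₀, fun N hN => ?_⟩
  have := hN₀ N hN
  rwa [mem_Iic, hsDiameter, one_mul] at this

end Literature.MathematicalPhysics.KineticTheory

end
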